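import Literature.AnabelianGeometry.EtaleTheta.Discharge.Sec2BiThetaAutLift
import Literature.AnabelianGeometry.EtaleTheta.Discharge.Sec2BiThetaConjTransport
import Literature.AnabelianGeometry.EtaleTheta.Discharge.Sec2Prop214iiiInversionOfModel
import Literature.AnabelianGeometry.EtaleTheta.Discharge.Sec2Cor216OfModel

/-!
# [EtTh] Prop 2.14 (iii), BI-theta case, the `{±1}`-part AT THE §1 MODEL: a lift of the inversion fixing
# the theta COCYCLE lifts to every model bi-theta environment `B_N(η)` (proof-only companion)

Mochizuki, *The Étale Theta Function and its Frobenioid-theoretic Manifestations* [EtTh], Publ. RIMS 45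
(2009), §2, Prop 2.14 (iii) p.50: "In the bi-theta case … This shows that `Im_N ⊇ (N·l·ℤ) ⋊ {±1}`"
(locators `p.N` = PDF pages of the PRIMS text; bib key `MochizukiEtTh2009`). PROOF-ONLY companion (no
`def`; seat abc-iut-L2-t2, §2 owner) of `ThetaRigidity.lean` (`RigidData.Prop214_iii_bi`) at abc-iut-L2-t8's
§1 instantiation `C.rigidData` (`RigidOfSetting.lean`), continuing `Discharge/Sec2BiThetaAutLift.lean`
(generic bi lift), `Discharge/Sec2BiThetaConjTransport.lean` (`conjX g : B(η) ≃ B(g·η)`), this seat's g3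
`Discharge/Sec2Prop214iiiTranslationsOfModel.lean` (the `N·(l·ℤ)`-translations) and g4
`Discharge/Sec2Prop214iiiInversionOfModel.lean` (the MONO `{±1}`-part from the CLASS-level datum `hιη`).

WHY A COCYCLE-LEVEL DATUM. For the mono-theta environment `M(η)` it suffices that the inversion carry the
étale theta class `η̈^Θ` to a `Π^tp_X̲̲`-conjugate (`hιη`, GAP row G-L2t2-1): the discrepancy is a
`K^×`-Kummer shift, which lies in `D_Y`. A bi-theta environment also records `[Im s^alg_Ÿ]`, which a
non-trivial Kummer shift moves; by `Discharge/Sec2BiThetaAutCriterion.lean` an automorphism of `B(η)` over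
`φ` EXISTS iff the transform of `η` is `η` up to a `μ_N`-coboundary. At the level of the `l·Δ_Θ`-valued
root cocycles of `X̲̲` (abc-iut-L2-t8's `rootCocycles`, the lifts of the `Π^tp_X̲̲`-conjugates of
`η̈^Θ|_{Π^tp_Ÿ̲̲}`, Def 2.7 p.41) class-level invariance leaves a `Δ_Θ`-coboundary `∂a` with `a ∈ Δ_Θ`, whose
reduction mod `N` is a `μ_N`-coboundary when `a ∈ l·Δ_Θ` — but for `a ∉ l·Δ_Θ` it is the inflated Kummer
class of an element of `μ_l`, in general NOT a coboundary (`l ∣ N`). Hence the datum here is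
COCYCLE-level: `γ^Θ ∘ F ∘ ι⁻¹ = F · ∂a` with `a ∈ l·Δ_Θ` for a cocycle `F` representing `η̈^Θ` (print:
"`Θ̈(Ü) = −Θ̈(Ü⁻¹)`; `Θ̈(−Ü) = −Θ̈(Ü)`", Prop 1.4 (ii) p.22, so the lift `Ü ↦ −Ü⁻¹` fixes the FUNCTION `Θ̈`;
abc-iut-L2-d1's `transportFun_thetaCocycleχ_twistedInversion` is the instance `a = 1` at the χ-model).

* `rigidData_exists_biIso_over_aut_of_rootCocycle` — for `R = C.rigidData μ hC hS h15 L`, the §1 datum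
  `(ι, c : ThetaCompanion ι, Thm16i ι, ι(Π^tp_X̲̲) = Π^tp_X̲̲, hιY, hιΔ)` with a restriction `φ` of `ι` to
  `Π^tp_X̲̲`, and a ROOT COCYCLE `f` with `f ∘ ι⁻¹ = f · ∂a` (`a ∈ l·Δ_Θ`): `(m, y) ↦ (m, φ y)` IS an
  automorphism of the model bi-theta environment `B_N(red ∘ f)` over `ι`, trivial on `μ_N`
  (`RigidData.exists_biIso_over_aut` with `ψ = 1`, `m = red(a)⁻¹`; `red(∂a) = ∂(red a)` by the
  `G_K`-equivariance of `(l·Δ_Θ) ↠ μ_N`, this seat's g3 `CyclotomeMod.red_cob`).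
* `rootCocycle_comp_symm_of_transportFun` — from the datum on `Π^tp_Ÿ` (`γ^Θ ∘ F ∘ ι⁻¹ = F·∂a`, `γ^Θ = +1`
  on `Δ_Θ`, Prop 2.2 (i) p.37) to root cocycles: `F|_{Π^tp_Ÿ̲̲} · ∂b` satisfies `f ∘ ι⁻¹ = f·∂a`
  (coboundaries are `ι`-invariant since `(·)^Θ ∘ ι⁻¹ = (γ^Θ)⁻¹ ∘ (·)^Θ` and `γ^Θ` fixes `Δ_Θ`).
* **`rigidData_exists_biIso_over_conjInversion`** — for EVERY mod-`N` theta cocycle `η` of `X̲̲`: writing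
  its root cocycle as `f = (σ·F)|·∂b` (`σ ∈ Π^tp_X̲̲`, Def 2.7: the collection is the `Π^tp_X̲̲`-orbit), the
  cocycle `f₁ := F|·∂(σ⁻¹·b)` is a root cocycle with `σ·(red ∘ f₁) = η` ON THE NOSE and `f₁ ∘ ι⁻¹ = f₁·∂a`,
  so `B(η) ≃ B(red ∘ f₁)` by `conjX σ` and the lift of `ι` to `B(red ∘ f₁)` conjugates to an automorphism of
  `B_N(η)` inducing the `σ`-CONJUGATED inversion `y ↦ σ·ι(σ⁻¹ y σ)·σ⁻¹` on `Π^tp_Y̲̲` — the EXISTENCE content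
  of the `{±1}`-factor of `Im_N ⊇ (N·l·ℤ) ⋊ {±1}`; `…_tower` at every level of a `CyclotomeTower`.
RESIDUAL (honest): the cocycle-level datum is a HYPOTHESIS on the §1 data (no carrier for `Θ̈` as a function
under an outer automorphism in the §1 typing; instance at the χ-model by abc-iut-L2-d1); the cusp-LABEL clause
`RigidData.ActsOnCuspsBy _ _ (-1)` is interface input (`C.CuspLabels` carries no equivariance). HONEST
FRAMING: [EtTh] is refereed; OUR kernel checks at the cell's §1 model; no side is taken on [IUTchIII]
Cor 3.12; typed ≠ discharged elsewhere.
-/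

noncomputable section

namespace Literature.AnabelianGeometry.EtaleTheta

open Literature.AnabelianGeometry.SemiGraphs
open scoped IsMulCommutative

namespace ThetaSetting

variable {p : ℕ} [Fact p.Prime] {D : ThetaSetting p}

/-! ## Coboundaries of `Δ_Θ` are invariant under the inversion datum -/

/-- For an automorphism `ι` of `Π^tp_X` with a theta companion `γ^Θ` acting by `+1` on `Δ_Θ`
(Prop 2.2 (i)): `(ι⁻¹ h)^Θ · b · ((ι⁻¹ h)^Θ)⁻¹ = h^Θ · b · (h^Θ)⁻¹` for `b ∈ Δ_Θ` — coboundaries of `Δ_Θ` are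
`ι`-invariant. [cite: MochizukiEtTh2009, Prop 2.2 (i) p.37] -/
theorem conjNormal_toTheta_symm_eq (ι : D.PiTemp ≃ₜ* D.PiTemp) (c : ThetaCompanion ι)
    (hβ : ∀ a ∈ D.DeltaTheta, c.thetaIso a = a) (h : D.PiTemp) (b : D.DeltaTheta) :
    MulAut.conjNormal (D.toTheta (ι.symm h)) b = MulAut.conjNormal (D.toTheta h) b := by
  apply Subtype.ext
  have hmem : (MulAut.conjNormal (D.toTheta (ι.symm h)) b : D.GtpTheta) ∈ D.DeltaTheta :=
    (MulAut.conjNormal (D.toTheta (ι.symm h)) b).2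
  rw [← hβ _ hmem]
  simp only [MulAut.conjNormal_apply, map_mul, map_inv, ThetaCompanion.comm' ι c,
    ContinuousMulEquiv.apply_symm_apply, hβ _ b.2]

namespace EtaleThetaData.DoubleUnderline

variable {E : D.EtaleThetaData} {l : ℕ} (C : E.DoubleUnderline l) {N : ℕ+} (μ : D.CyclotomeMod l N)
  (ι : D.PiTemp ≃ₜ* D.PiTemp)

/-! ## From the datum on `Π^tp_Ÿ` to root cocycles on `Π^tp_Ÿ̲̲` -/

/-- **Root cocycles of the shape `F|_{Π^tp_Ÿ̲̲} · ∂b` inherit `f ∘ ι⁻¹ = f · ∂a` from `γ^Θ ∘ F ∘ ι⁻¹ = F · ∂a`**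
(`γ^Θ = +1` on `Δ_Θ`; coboundaries are `ι`-invariant). [cite: MochizukiEtTh2009, Prop 2.14(iii) p.50] -/
theorem rootCocycle_comp_symm_of_transportFun (c : ThetaCompanion ι) (h : Thm16i ι)
    (hι : C.Huu.map ι.toMulEquiv.toMonoidHom = C.Huu)
    (hβ : ∀ a ∈ D.DeltaTheta, c.thetaIso a = a)
    {F : D.GtpYdd → D.DeltaTheta} (a : D.DeltaTheta)
    (hFa : transportFun c h F = fun g => F g * (MulAut.conjNormal (D.toTheta (g : D.PiTemp)) a * a⁻¹))
    (b : D.DeltaTheta) (f : C.GtpYdduu → D.DeltaTheta)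
    (hf : ∀ g : C.GtpYdduu, f g = F ⟨g, (Subgroup.mem_inf.1 g.2).1⟩ *
      (MulAut.conjNormal (D.toTheta (g : D.PiTemp)) b * b⁻¹))
    (g : C.GtpYdduu) :
    f ⟨ι.symm g, C.symm_mem_GtpYdduu ι h hι g g.2⟩ =
      f g * (MulAut.conjNormal (D.toTheta (g : D.PiTemp)) a * a⁻¹) := by
  set g' : C.GtpYdduu := ⟨ι.symm g, C.symm_mem_GtpYdduu ι h hι g g.2⟩ with hg'
  have hFg := congrFun hFa ⟨g, (Subgroup.mem_inf.1 g.2).1⟩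
  -- `γ^Θ (F (ι⁻¹ g)) = F g · ∂a(g)`, and `γ^Θ` fixes `Δ_Θ`
  have hF' : F ⟨g', (Subgroup.mem_inf.1 g'.2).1⟩ = F ⟨g, (Subgroup.mem_inf.1 g.2).1⟩ *
      (MulAut.conjNormal (D.toTheta (g : D.PiTemp)) a * a⁻¹) := by
    rw [← hFg]
    apply Subtype.ext
    change _ = c.thetaIso (F ⟨ι.toMulEquiv.symm (g : D.PiTemp), _⟩).1
    rw [hβ _ (F _).2]
    rfl
  have hcob : MulAut.conjNormal (D.toTheta (g' : D.PiTemp)) b =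
      MulAut.conjNormal (D.toTheta (g : D.PiTemp)) b :=
    conjNormal_toTheta_symm_eq ι c hβ g b
  rw [hf g', hf g, hF', hcob]
  exact mul_right_comm _ _ _

/-! ## The per-automorphism lift at the model from a root cocycle with `f ∘ ι⁻¹ = f · ∂a` -/

/-- **[EtTh] Prop 2.14 (iii), BI case, AT THE §1 MODEL, from an `ι`-invariant root cocycle.** For
`R = C.rigidData μ hC hS h15 L`, an automorphism `ι` of `Π^tp_X` with theta companion `c` (Thm 1.6 (ii)),
`ι(Π^tp_Ÿ) = Π^tp_Ÿ` (Thm 1.6 (i)), `ι(Π^tp_X̲̲) = Π^tp_X̲̲` (Def 2.5 (i)), `ι(Π^tp_Y) = Π^tp_Y`, `ι(Δ^tp_X) = Δ^tp_X`,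
a restriction `φ` of `ι` to `Π^tp_X̲̲`, and a root cocycle `f` with `f ∘ ι⁻¹ = f · ∂a`, `a ∈ l·Δ_Θ`: the map
`(m, y) ↦ (m, φ y)` IS an automorphism of the model bi-theta environment `B_N(red ∘ f)` inducing `φ` on
`Π^tp_Y̲̲` and the identity on `μ_N`. [cite: MochizukiEtTh2009, Prop 2.14(iii) p.50] -/
theorem rigidData_exists_biIso_over_aut_of_rootCocycle (c : ThetaCompanion ι) (h : Thm16i ι)
    (hι : C.Huu.map ι.toMulEquiv.toMonoidHom = C.Huu) (φ : ↥C.Huu ≃ₜ* ↥C.Huu)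
    (hφ : ∀ x : C.Huu, ((φ x : C.Huu) : D.PiTemp) = ι x) (hC : D.Compat) (hS : D.Sec2Hyps)
    (h15 : Prop15iii E hC) (L : C.CuspLabels)
    (hιY : ∀ x : D.PiTemp, x ∈ D.GtpY ↔ ι x ∈ D.GtpY)
    (hιΔ : ∀ x : D.PiTemp, D.aug x = 1 ↔ D.aug (ι x) = 1)
    {f : contCocycles D.toTheta D.DeltaTheta C.GtpYdduu} (hf : f ∈ C.rootCocycles hC)
    (a : D.DeltaTheta) (ha : (a : D.GtpTheta) ∈ D.lDeltaTheta l)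
    (hfa : ∀ g : C.GtpYdduu, f.1 ⟨ι.symm g, C.symm_mem_GtpYdduu ι h hι g g.2⟩ =
      f.1 g * (MulAut.conjNormal (D.toTheta (g : D.PiTemp)) a * a⁻¹)) :
    ∃ α : ((C.rigidData μ hC hS h15 L).modelBi
        (show C.modN μ f hf.1 ∈ (C.rigidData μ hC hS h15 L).thetaCocycles from ⟨f, hf, rfl⟩)).Iso
      ((C.rigidData μ hC hS h15 L).modelBi
        (show C.modN μ f hf.1 ∈ (C.rigidData μ hC hS h15 L).thetaCocycles from ⟨f, hf, rfl⟩)),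
      (∀ x, ((CycEnvelope.proj (C.rigidData μ hC hS h15 L).augY (C.rigidData μ hC hS h15 L).chi (α.e x) :
          (C.rigidData μ hC hS h15 L).PiY) : C.Huu) =
        φ ((CycEnvelope.proj (C.rigidData μ hC hS h15 L).augY (C.rigidData μ hC hS h15 L).chi x :
          (C.rigidData μ hC hS h15 L).PiY) : C.Huu)) ∧
      ∀ m, α.e (CycEnvelope.inMu (C.rigidData μ hC hS h15 L).augY (C.rigidData μ hC hS h15 L).chi m) =
        CycEnvelope.inMu (C.rigidData μ hC hS h15 L).augY (C.rigidData μ hC hS h15 L).chi m := by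
  set R := C.rigidData μ hC hS h15 L with hR
  -- the five Cor 2.18 (i) clauses for `φ` (as in this seat's g4 `rigidData_exists_monoIso_over_inversion`)
  have hY' : R.PiY.map φ.toMulEquiv.toMonoidHom = R.PiY :=
    C.map_eq_of_invariant ι φ hφ (· ∈ D.GtpY) hιY _ fun x => Subgroup.mem_subgroupOf
  have hdd' : R.PiYdd.map φ.toMulEquiv.toMonoidHom = R.PiYdd :=
    C.map_eq_of_invariant ι φ hφ (· ∈ D.GtpYdd) (mem_GtpYdd_iff_of_thm16i ι h) _
      fun x => Subgroup.mem_subgroupOf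
  have hker' : R.aug.ker.map φ.toMulEquiv.toMonoidHom = R.aug.ker :=
    C.map_eq_of_invariant ι φ hφ (fun x => D.aug x = 1) hιΔ _ fun x => by
      rw [MonoidHom.mem_ker]
      exact ⟨fun hx => congrArg Subtype.val hx, fun hx => Subtype.ext hx⟩
  have hK' : R.thetaKer.map φ.toMulEquiv.toMonoidHom = R.thetaKer :=
    C.map_eq_of_invariant ι φ hφ (fun x => D.toTheta x = 1) (ThetaCompanion.toTheta_eq_one_iff ι c) _
      fun x => by rw [MonoidHom.mem_ker]; rfl
  have hL' : R.lDeltaTheta.map φ.toMulEquiv.toMonoidHom = R.lDeltaTheta :=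
    C.map_eq_of_invariant ι φ hφ (fun x => D.toTheta x ∈ D.lDeltaTheta l)
      (fun x => by rw [ThetaCompanion.mem_lDeltaTheta_iff ι c, ThetaCompanion.comm' ι c]) _
      fun x => by rw [Subgroup.mem_comap]; rfl
  -- exact invariance up to the coboundary of `red(a)⁻¹`
  have hηm : ∀ d d' : R.PiYdd, φ (d : R.PiX) = d' → (MulEquiv.refl R.mu) (C.modN μ f hf.1 d) =
      C.modN μ f hf.1 d' *
        CycEnvelope.coboundary (R.aug.comp R.PiYdd.subtype) R.chi (μ.red ⟨a, ha⟩)⁻¹ d' := by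
    intro d d' hdd'
    have hd : ((C.inclYdduu d : C.GtpYdduu) : D.PiTemp) =
        ι.symm ((C.inclYdduu d' : C.GtpYdduu) : D.PiTemp) := by
      change ((d : C.Huu) : D.PiTemp) = ι.symm ((d' : C.Huu) : D.PiTemp)
      have h1 : (d : C.Huu) = φ.symm (d' : C.Huu) := by
        rw [← hdd']; exact (φ.symm_apply_apply _).symm
      rw [h1, C.coe_symm_of_coe_eq ι φ hφ]
    have harg : C.inclYdduu d = ⟨ι.symm ((C.inclYdduu d' : C.GtpYdduu) : D.PiTemp),
        C.symm_mem_GtpYdduu ι h hι _ (C.inclYdduu d').2⟩ := Subtype.ext hd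
    have hfd : f.1 (C.inclYdduu d) = f.1 (C.inclYdduu d') *
        (MulAut.conjNormal (D.toTheta ((C.inclYdduu d' : C.GtpYdduu) : D.PiTemp)) a * a⁻¹) := by
      rw [harg]
      exact hfa (C.inclYdduu d')
    have hcobmem : ((MulAut.conjNormal (D.toTheta ((C.inclYdduu d' : C.GtpYdduu) : D.PiTemp)) a * a⁻¹ :
        D.DeltaTheta) : D.GtpTheta) ∈ D.lDeltaTheta l := by
      have h1 : (MulAut.conjNormal (D.toTheta ((C.inclYdduu d' : C.GtpYdduu) : D.PiTemp)) a * a⁻¹ :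
          D.DeltaTheta) = (f.1 (C.inclYdduu d'))⁻¹ * f.1 (C.inclYdduu d) := by
        rw [hfd, inv_mul_cancel_left]
      rw [h1, Subgroup.coe_mul, Subgroup.coe_inv]
      exact mul_mem (inv_mem (hf.1 _)) (hf.1 _)
    have hred : μ.red ⟨(f.1 (C.inclYdduu d) : D.GtpTheta), hf.1 _⟩ =
        μ.red ⟨(f.1 (C.inclYdduu d') : D.GtpTheta), hf.1 _⟩ * μ.red ⟨_, hcobmem⟩ := by
      rw [← map_mul]
      exact CyclotomeMod.red_eq_of_val_eq μ _ _ (by rw [hfd, Subgroup.coe_mul])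
    change μ.red ⟨(f.1 (C.inclYdduu d) : D.GtpTheta), hf.1 _⟩ =
      μ.red ⟨(f.1 (C.inclYdduu d') : D.GtpTheta), hf.1 _⟩ * _
    rw [hred, CyclotomeMod.red_cob μ _ a ha hcobmem]
    congr 1
    change _ = (μ.red ⟨a, ha⟩)⁻¹ *
      (galMuN p N (D.aug.toMonoidHom ((d' : C.Huu) : D.PiTemp)) (μ.red ⟨a, ha⟩)⁻¹)⁻¹
    rw [map_inv, inv_inv, mul_comm]
    rfl
  obtain ⟨α, hα, hαμ⟩ := R.exists_biIso_over_aut ⟨f, hf, rfl⟩ φ hY' hdd' hker' hK' hL'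
    (MulEquiv.refl _) ((μ.red ⟨a, ha⟩)⁻¹) hηm
  exact ⟨α, hα, fun m => by rw [hαμ, MulEquiv.refl_apply]⟩

/-! ## Every theta cocycle: the conjugated inversion -/

/-- **The orbit decomposition of a root cocycle**: if `F` represents `η̈^Θ` on `Π^tp_Ÿ`, every root cocycle
`f` of `X̲̲` is `(σ·F)|_{Π^tp_Ÿ̲̲} · ∂b` POINTWISE for some `σ ∈ Π^tp_X̲̲`, `b ∈ Δ_Θ` (Def 2.7: the classes
`η̲̈^{Θ,l·ℤ×μ₂}` are the `Π^tp_X̲̲`-orbit of `η̈^Θ|`). [cite: MochizukiEtTh2009, Def 2.7 p.41] -/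
theorem exists_eq_conj_mul_cob_of_rootCocycle (hC : D.Compat) {F : D.GtpYdd → D.DeltaTheta}
    (hF : F ∈ contCocycles D.toTheta D.DeltaTheta D.GtpYdd) (hFE : ContH1.mk F hF = E.etaDd)
    {f : contCocycles D.toTheta D.DeltaTheta C.GtpYdduu} (hf : f ∈ C.rootCocycles hC) :
    ∃ σ ∈ C.Huu, ∃ b : D.DeltaTheta, ∀ g : C.GtpYdduu, f.1 g =
      MulAut.conjNormal (D.toTheta σ) (F ⟨σ⁻¹ * g * σ, hC.GtpYdd_normal.conj_mem' _
        (Subgroup.mem_inf.1 g.2).1 σ⟩) * (MulAut.conjNormal (D.toTheta (g : D.PiTemp)) b * b⁻¹) := by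
  haveI := hC.GtpYdd_normal
  obtain ⟨σ, hσ, hclass⟩ := hf.2
  refine ⟨σ, hσ, ?_⟩
  rw [← hFE] at hclass
  change (QuotientGroup.mk f : D.H1 C.GtpYdduu) =
    QuotientGroup.mk (ContH1.resCocycle D.toTheta D.DeltaTheta inf_le_left
      (ContH1.conjCocycle D.toTheta D.DeltaTheta σ ⟨F, hF⟩)) at hclass
  rw [QuotientGroup.eq, Subgroup.mem_subgroupOf] at hclass
  obtain ⟨b, hb⟩ := (mem_contCoboundaries_iff _).1 hclass
  refine ⟨b⁻¹, fun g => ?_⟩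
  have hbg := congrFun hb g
  change (f.1 g)⁻¹ * (ContH1.resCocycle D.toTheta D.DeltaTheta inf_le_left
      (ContH1.conjCocycle D.toTheta D.DeltaTheta σ ⟨F, hF⟩)).1 g = _ at hbg
  have hfg : f.1 g = (ContH1.resCocycle D.toTheta D.DeltaTheta inf_le_left
      (ContH1.conjCocycle D.toTheta D.DeltaTheta σ ⟨F, hF⟩)).1 g *
        (MulAut.conjNormal (D.toTheta (g : D.PiTemp)) b * b⁻¹)⁻¹ := by
    rw [← hbg, mul_inv_rev, inv_inv, mul_inv_cancel_left]
  rw [hfg]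
  congr 1
  · change MulAut.conjNormal (D.toTheta σ) (F (MulAut.conjNormal σ⁻¹ ⟨(g : D.PiTemp), _⟩)) = _
    congr 2
    apply Subtype.ext
    simp only [MulAut.conjNormal_apply, inv_inv]
  · rw [mul_inv_rev, inv_inv, map_inv, mul_comm]

/-- The cocycle `f₁ := F|_{Π^tp_Ÿ̲̲} · ∂b₁` attached to `F` and `b₁ ∈ Δ_Θ`, as an element of the continuous
cocycles on `Π^tp_Ÿ̲̲` (restriction times a coboundary). [cite: MochizukiEtTh2009, Def 2.7 p.41] -/
theorem resCocycle_mul_cob_apply {F : D.GtpYdd → D.DeltaTheta}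
    (hF : F ∈ contCocycles D.toTheta D.DeltaTheta D.GtpYdd) (b₁ : D.DeltaTheta) (g : C.GtpYdduu) :
    (ContH1.resCocycle D.toTheta D.DeltaTheta (inf_le_left : C.GtpYdduu ≤ D.GtpYdd) ⟨F, hF⟩ *
        ⟨_, coboundary_mem_contCocycles b₁ C.GtpYdduu⟩).1 g =
      F ⟨g, (Subgroup.mem_inf.1 g.2).1⟩ * (MulAut.conjNormal (D.toTheta (g : D.PiTemp)) b₁ * b₁⁻¹) :=
  rfl

/-- **[EtTh] Prop 2.14 (iii), BI-theta case, `{±1}`-part AT THE §1 MODEL.** For `R = C.rigidData μ hC hS h15 L`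
and the §1 inversion datum — `ι ∈ Aut_top(Π^tp_X)` with theta companion `c` (Thm 1.6 (ii)), `ι(Π^tp_Ÿ) = Π^tp_Ÿ`
(Thm 1.6 (i)), `ι(Π^tp_X̲̲) = Π^tp_X̲̲` (Def 2.5 (i)) with restriction `φ`, `ι(Π^tp_Y) = Π^tp_Y`, `ι(Δ^tp_X) = Δ^tp_X`,
`γ^Θ = +1` on `Δ_Θ` (Prop 2.2 (i)) — carrying a cocycle `F` of the étale theta class `η̈^Θ` to `F · ∂a`,
`a ∈ l·Δ_Θ` (cocycle level; "`Θ̈(Ü) = −Θ̈(Ü⁻¹)`; `Θ̈(−Ü) = −Θ̈(Ü)`", Prop 1.4 (ii)): for EVERY mod-`N` theta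
cocycle `η` there are `σ ∈ Π^tp_X̲̲` and an AUTOMORPHISM OF THE MODEL BI-THETA ENVIRONMENT `B_N(η)` inducing
the `σ`-conjugated inversion `y ↦ σ·ι(σ⁻¹ y σ)·σ⁻¹` on `Π^tp_Y̲̲` — the existence content of the `{±1}`-factor
of "`Im_N ⊇ (N·l·ℤ) ⋊ {±1}`". [cite: MochizukiEtTh2009, Prop 2.14(iii) p.50] -/
theorem rigidData_exists_biIso_over_conjInversion (c : ThetaCompanion ι) (h : Thm16i ι)
    (hι : C.Huu.map ι.toMulEquiv.toMonoidHom = C.Huu) (φ : ↥C.Huu ≃ₜ* ↥C.Huu)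
    (hφ : ∀ x : C.Huu, ((φ x : C.Huu) : D.PiTemp) = ι x) (hC : D.Compat) (hS : D.Sec2Hyps)
    (h15 : Prop15iii E hC) (L : C.CuspLabels)
    (hιY : ∀ x : D.PiTemp, x ∈ D.GtpY ↔ ι x ∈ D.GtpY)
    (hιΔ : ∀ x : D.PiTemp, D.aug x = 1 ↔ D.aug (ι x) = 1)
    (hβ : ∀ a ∈ D.DeltaTheta, c.thetaIso a = a)
    (hιF : ∃ (F : D.GtpYdd → D.DeltaTheta) (hF : F ∈ contCocycles D.toTheta D.DeltaTheta D.GtpYdd)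
      (a : D.DeltaTheta), ContH1.mk F hF = E.etaDd ∧ (a : D.GtpTheta) ∈ D.lDeltaTheta l ∧
        transportFun c h F = fun g => F g * (MulAut.conjNormal (D.toTheta (g : D.PiTemp)) a * a⁻¹))
    {η : D.GtpYdd.subgroupOf C.Huu → MuN p N} (hη : η ∈ C.thetaCocycles hC μ) :
    ∃ (σ : C.Huu) (α : ((C.rigidData μ hC hS h15 L).modelBi hη).Iso ((C.rigidData μ hC hS h15 L).modelBi hη)),
      ∀ x, (((CycEnvelope.proj (C.rigidData μ hC hS h15 L).augY (C.rigidData μ hC hS h15 L).chi (α.e x) :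
          (C.rigidData μ hC hS h15 L).PiY) : C.Huu) : D.PiTemp) =
        σ * ι ((σ : D.PiTemp)⁻¹ * ((CycEnvelope.proj (C.rigidData μ hC hS h15 L).augY
          (C.rigidData μ hC hS h15 L).chi x : (C.rigidData μ hC hS h15 L).PiY) : C.Huu) * σ) *
          (σ : D.PiTemp)⁻¹ := by
  haveI := hC.GtpYdd_normal
  obtain ⟨F, hF, a, hFE, ha, hFa⟩ := hιF
  obtain ⟨f, hf, rfl⟩ := hη
  obtain ⟨σ, hσ, b, hfb⟩ := C.exists_eq_conj_mul_cob_of_rootCocycle hC hF hFE hf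
  have hmemσ : ∀ g : C.GtpYdduu, σ * (g : D.PiTemp) * σ⁻¹ ∈ C.GtpYdduu := fun g => by
    simpa using C.inv_mul_mul_mem_GtpYdduu hC ⟨σ⁻¹, C.Huu.inv_mem hσ⟩ g
  -- the root cocycle `f₁ := F| · ∂(σ⁻¹·b)` with `σ·(red ∘ f₁) = red ∘ f` on the nose
  set b₁ : D.DeltaTheta := MulAut.conjNormal (D.toTheta σ)⁻¹ b with hb₁
  set f₁ : contCocycles D.toTheta D.DeltaTheta C.GtpYdduu :=
    ContH1.resCocycle D.toTheta D.DeltaTheta (inf_le_left : C.GtpYdduu ≤ D.GtpYdd) ⟨F, hF⟩ *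
      ⟨_, coboundary_mem_contCocycles b₁ C.GtpYdduu⟩ with hf₁
  have hf₁g : ∀ g : C.GtpYdduu, f₁.1 g =
      F ⟨g, (Subgroup.mem_inf.1 g.2).1⟩ * (MulAut.conjNormal (D.toTheta (g : D.PiTemp)) b₁ * b₁⁻¹) :=
    fun g => by rw [hf₁]; exact C.resCocycle_mul_cob_apply hF b₁ g
  -- pointwise: `f(σ g σ⁻¹) = σ^Θ · f₁(g) · (σ^Θ)⁻¹`
  have hkey : ∀ g : C.GtpYdduu, ((f.1 ⟨σ * g * σ⁻¹, hmemσ g⟩ : D.DeltaTheta) : D.GtpTheta) =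
      D.toTheta σ * f₁.1 g * (D.toTheta σ)⁻¹ := by
    intro g
    have e1 : (⟨σ⁻¹ * ((⟨σ * g * σ⁻¹, hmemσ g⟩ : C.GtpYdduu) : D.PiTemp) * σ,
        hC.GtpYdd_normal.conj_mem' _ (Subgroup.mem_inf.1 (⟨σ * g * σ⁻¹, hmemσ g⟩ : C.GtpYdduu).2).1 σ⟩ :
          D.GtpYdd) = ⟨g, (Subgroup.mem_inf.1 g.2).1⟩ := by
      apply Subtype.ext
      change σ⁻¹ * (σ * (g : D.PiTemp) * σ⁻¹) * σ = g
      group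
    rw [hfb, hf₁g, e1, hb₁]
    simp only [Subgroup.coe_mul, Subgroup.coe_inv, MulAut.conjNormal_apply]
    simp only [map_mul, map_inv]
    group
  -- (1) `f₁` is a root cocycle
  have hf₁val : ∀ g, (f₁.1 g : D.GtpTheta) ∈ D.lDeltaTheta l := fun g => by
    have h1 : (f₁.1 g : D.GtpTheta) =
        (D.toTheta σ)⁻¹ * (f.1 ⟨σ * g * σ⁻¹, hmemσ g⟩ : D.DeltaTheta) * (D.toTheta σ)⁻¹⁻¹ := by
      rw [hkey, inv_inv]; group
    rw [h1]
    exact (D.lDeltaTheta_normal l).conj_mem _ (hf.1 _) _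
  have hf₁class : ContH1.mk f₁.1 f₁.2 ∈ C.etaOrbit hC := by
    refine ⟨1, one_mem _, ?_⟩
    rw [contH1_conj_one, ← hFE]
    change (QuotientGroup.mk f₁ : D.H1 C.GtpYdduu) =
      QuotientGroup.mk (ContH1.resCocycle D.toTheta D.DeltaTheta inf_le_left ⟨F, hF⟩)
    rw [QuotientGroup.eq, Subgroup.mem_subgroupOf, hf₁, mul_inv_rev, mul_assoc, inv_mul_cancel, mul_one]
    exact inv_mem ((mem_contCoboundaries_iff _).2 ⟨b₁, rfl⟩)
  have hf₁root : f₁ ∈ C.rootCocycles hC := ⟨hf₁val, hf₁class⟩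
  -- (2) `f₁ ∘ ι⁻¹ = f₁ · ∂a`
  have hf₁a : ∀ g : C.GtpYdduu, f₁.1 ⟨ι.symm g, C.symm_mem_GtpYdduu ι h hι g g.2⟩ =
      f₁.1 g * (MulAut.conjNormal (D.toTheta (g : D.PiTemp)) a * a⁻¹) :=
    C.rootCocycle_comp_symm_of_transportFun ι c h hι hβ a hFa b₁ (fun g => f₁.1 g) hf₁g
  -- (3) `σ·(red ∘ f₁) = red ∘ f` on the nose
  have hconj : ∀ k : (C.thetaEnvData μ hC hS).PiYdd, (C.thetaEnvData μ hC hS).chi ((C.thetaEnvData μ hC hS).aug (⟨σ, hσ⟩ : C.Huu))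
      (C.modN μ f₁ hf₁val ⟨(⟨σ, hσ⟩ : C.Huu)⁻¹ * k * ⟨σ, hσ⟩,
        by simpa [mul_assoc] using (C.thetaEnvData μ hC hS).PiYdd_normal.conj_mem _ k.2 (⟨σ, hσ⟩ : C.Huu)⁻¹⟩) =
      C.modN μ f hf.1 k * CycEnvelope.coboundary ((C.thetaEnvData μ hC hS).aug.comp (C.thetaEnvData μ hC hS).PiYdd.subtype) (C.thetaEnvData μ hC hS).chi (1 : MuN p N) k := by
    intro k
    have h1 : CycEnvelope.coboundary ((C.thetaEnvData μ hC hS).aug.comp (C.thetaEnvData μ hC hS).PiYdd.subtype) (C.thetaEnvData μ hC hS).chi (1 : MuN p N) k = 1 := by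
      change (1 : MuN p N) * (galMuN p N (D.aug.toMonoidHom ((k : C.Huu) : D.PiTemp)) 1)⁻¹ = 1
      rw [map_one, inv_one, mul_one]
    rw [h1, mul_one]
    change galMuN p N (D.aug.toMonoidHom σ) (μ.red ⟨(f₁.1 _ : D.GtpTheta), hf₁val _⟩) =
      μ.red ⟨(f.1 (C.inclYdduu k) : D.GtpTheta), hf.1 _⟩
    rw [← μ.red_conj]
    apply CyclotomeMod.red_eq_of_val_eq μ
    dsimp only
    rw [← hkey]
    exact congrArg (fun y : C.GtpYdduu => ((f.1 y : D.DeltaTheta) : D.GtpTheta))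
      (Subtype.ext (by
        change σ * ((σ : D.PiTemp)⁻¹ * ((k : C.Huu) : D.PiTemp) * σ) * σ⁻¹ = ((k : C.Huu) : D.PiTemp)
        group))
  -- (4) lift `ι` to `B(red ∘ f₁)` and conjugate by `conjX σ`
  obtain ⟨α₁, hα₁, -⟩ := C.rigidData_exists_biIso_over_aut_of_rootCocycle μ ι c h hι φ hφ hC hS h15 L hιY
    hιΔ hf₁root a ha hf₁a
  obtain ⟨α, hα⟩ := (C.thetaEnvData μ hC hS).exists_biIso_over_conj_of_conj_eq ⟨f₁, hf₁root, rfl⟩ ⟨f, hf, rfl⟩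
    ⟨σ, hσ⟩ 1 hconj α₁ (fun y => φ y) hα₁
  refine ⟨⟨σ, hσ⟩, α, fun x => ?_⟩
  rw [hα x]
  change (σ : D.PiTemp) * ((φ ((⟨σ, hσ⟩ : C.Huu)⁻¹ * _ * ⟨σ, hσ⟩) : C.Huu) : D.PiTemp) * σ⁻¹ = _
  rw [hφ]
  rfl

/-- **The same at every level of a `CyclotomeTower`** (`R = C.rigidData (τ.mod M) hC hS h15 L`).
[cite: MochizukiEtTh2009, Prop 2.14(iii) p.50] -/
theorem rigidData_exists_biIso_over_conjInversion_tower {Es : Set ℕ+} (τ : D.CyclotomeTower l Es) (M : Es)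
    (c : ThetaCompanion ι) (h : Thm16i ι) (hι : C.Huu.map ι.toMulEquiv.toMonoidHom = C.Huu)
    (φ : ↥C.Huu ≃ₜ* ↥C.Huu) (hφ : ∀ x : C.Huu, ((φ x : C.Huu) : D.PiTemp) = ι x)
    (hC : D.Compat) (hS : D.Sec2Hyps) (h15 : Prop15iii E hC) (L : C.CuspLabels)
    (hιY : ∀ x : D.PiTemp, x ∈ D.GtpY ↔ ι x ∈ D.GtpY)
    (hιΔ : ∀ x : D.PiTemp, D.aug x = 1 ↔ D.aug (ι x) = 1)
    (hβ : ∀ a ∈ D.DeltaTheta, c.thetaIso a = a)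
    (hιF : ∃ (F : D.GtpYdd → D.DeltaTheta) (hF : F ∈ contCocycles D.toTheta D.DeltaTheta D.GtpYdd)
      (a : D.DeltaTheta), ContH1.mk F hF = E.etaDd ∧ (a : D.GtpTheta) ∈ D.lDeltaTheta l ∧
        transportFun c h F = fun g => F g * (MulAut.conjNormal (D.toTheta (g : D.PiTemp)) a * a⁻¹))
    {η : D.GtpYdd.subgroupOf C.Huu → MuN p M} (hη : η ∈ C.thetaCocycles hC (τ.mod M)) :
    ∃ (σ : C.Huu) (α : ((C.rigidData (τ.mod M) hC hS h15 L).modelBi hη).Iso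
        ((C.rigidData (τ.mod M) hC hS h15 L).modelBi hη)),
      ∀ x, (((CycEnvelope.proj (C.rigidData (τ.mod M) hC hS h15 L).augY
            (C.rigidData (τ.mod M) hC hS h15 L).chi (α.e x) :
          (C.rigidData (τ.mod M) hC hS h15 L).PiY) : C.Huu) : D.PiTemp) =
        σ * ι ((σ : D.PiTemp)⁻¹ * ((CycEnvelope.proj (C.rigidData (τ.mod M) hC hS h15 L).augY
          (C.rigidData (τ.mod M) hC hS h15 L).chi x :
            (C.rigidData (τ.mod M) hC hS h15 L).PiY) : C.Huu) * σ) * (σ : D.PiTemp)⁻¹ :=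
  C.rigidData_exists_biIso_over_conjInversion (τ.mod M) ι c h hι φ hφ hC hS h15 L hιY hιΔ hβ hιF hη

end EtaleThetaData.DoubleUnderline

end ThetaSetting

end Literature.AnabelianGeometry.EtaleTheta

end
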